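import Summits.BirchSwinnertonDyer.BirchSwinnertonDyer.Theorems.ManinLocalTwoThreeCDivisionOddAtFourOfFreyHabitat
import Summits.BirchSwinnertonDyer.BirchSwinnertonDyer.Theorems.ManinLocalTwoThreeAnchorDischarge
import Summits.BirchSwinnertonDyer.BirchSwinnertonDyer.Theorems.ManinLocalTwoThreeCDivisionIntegralCDT
import HarnessLib

/-!
# E-an-152d♭ UNCONDITIONALLY and C2 `ManinOddAtFour` ⟸ CDT ∧ E-an-152e
(route `ManinLocalTwoThree`, crux C2 `ManinOddAtFour` stmt-BirchSwinnertonDyer-22967; cell bsd-f2-manin, prover p3 gen 19; the capstone of the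
kernel port of -an's row E-an-152d)

The anchor hypothesis of `…CDivisionFullTwoTorsion` / `…CDivisionOddAtFourOfFreyHabitat` is discharged by
`EtaAnchor.anchor_exists` (`…AnchorDischarge`: sign characters of `Γ₀(N)/Γ₁(N)` are Kronecker symbols, Montgomery–Vaughan 9.13, and
the theta anchors `ϑ₄(2τ)³ϑ₄(2q₀τ)` carry them, Newman).  Hence:
* **`exists_three_hasRationalTwoTorsionX_of_indexFour`** — E-an-152d♭ IN THE KERNEL, no anchor binder: for `X₀(N)`-data `D` with the lattice
  clause `Λ_W = c₀Λ₀(f)`, `|c₀| = 2` and `Λ₁(f) = 2Λ₀(f)`, the curve has three distinct rational `2`-torsion abscissae;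
* **`indexFourForcesFullRationalTwoTorsion_of_two_dvd`** — the same phrased on the row's binders plus `2 ∣ c₀` replaced by `|c₀| = 2`;
* **`maninOddAtFour_of_CDT_freyHabitat'`** — `CDT_algInt → E-an-152e → C2`, and **`maninOddAtFour_of_CDTInt_freyHabitat'`** — `CDT (Theorem 1.0.1
  as printed, ℤ-coefficients) → E-an-152e → C2` (via p2's `CDivisionInt` chain): the line of record `cdivision_udc` for C2 now needs, besides the
  printed Calegari–Dimitrov–Tang theorem, only the index-`4` exclusion ON THE FREY HABITAT (`4 ∣ N`, odd part of `N` squarefree, full rational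
  `2`-torsion) — no F★ (Stevens' cusp rationality), no CES (optimal `X₁`-datum), no E-an-152c;
* **`maninConstantOne_of_printedFacts_CDTInt_freyHabitat'`** — the whole route: `ManinConstantOne ⟸ PrintedSemistableManinFacts ∧ CDT ∧ E-an-152e`.
HONEST FRAMING: CDT (`CalegariDimitrovTang2025_unboundedDenominators_algInt`, printed, unproved in the tree) and E-an-152e
(`CDivisionNeron.ShimuraIndexNeFourAtFourFreyHabitat`, `@[conjecture]`) remain hypotheses of the C2 statement; E-an-152d AS TYPED (without
`|c₀| = 2`) is not claimed; C2, Manin's conjecture and BSD are NOT proved here.  No definitions, no sorry.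
[cite: ShimuraIATAF1971, Thm. 3.52] [cite: MontgomeryVaughan2007, Theorem 9.13] [cite: Newman1959] [cite: CalegariDimitrovTang2025, Thm. 1.0.1]
-/

set_option autoImplicit false
-- lint-debt: the directory name repeats the summit name (sibling precedent `ManinLocalTwoThreeCDivisionGaloisEngine.lean`)
set_option linter.dupNamespace false

noncomputable section

open scoped Topology PeriodPair MatrixGroups ModularForm Manifold Classical
open Complex Filter PowerSeries CongruenceSubgroup
open UpperHalfPlane hiding I
open WeierstrassCurve Literature.NumberTheory.EllipticCurves Literature.NumberTheory.EllipticCurves.ModularForms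

namespace Summit.BirchSwinnertonDyer.BirchSwinnertonDyer.Theorems.ManinLocalTwoThree.CDivTranslate

variable {N : ℕ} [NeZero N]

/-- **E-an-152d♭ in the kernel (no anchor binder).**  For `X₀(N)`-parametrisation data `D` of a globally minimal `W/ℚ` with the lattice
clause `Λ_W = c₀·Λ₀(f)`, `|c₀| = 2` and `Λ₁(f) = 2Λ₀(f)` (Shimura index `4`), the curve has three distinct rational `2`-torsion abscissae
(full rational `2`-torsion).  Proof: `exists_three_hasRationalTwoTorsionX_of_indexFour_of_anchor` with the anchor supplied by
`EtaAnchor.anchor_exists`. [cite: ShimuraIATAF1971, Thm. 3.52] [cite: MontgomeryVaughan2007, Theorem 9.13] [cite: Newman1959] -/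
theorem exists_three_hasRationalTwoTorsionX_of_indexFour {W : WeierstrassCurve ℚ} [W.IsElliptic] [W.IsGloballyMinimal]
    (D : ModularParametrizationData W N)
    (hopt : ∀ z ∈ D.L.lattice, ∃ w ∈ periodLattice D.f, z = D.c * w) (hc2 : D.c.natAbs = 2)
    (hidx : ∀ z : ℂ, z ∈ periodLatticeGamma1 D.f ↔ ∃ w ∈ periodLattice D.f, z = 2 * w) :
    ∃ x₁ x₂ x₃ : ℚ, x₁ ≠ x₂ ∧ x₁ ≠ x₃ ∧ x₂ ≠ x₃ ∧
      Literature.NumberTheory.EllipticCurves.Greenberg1999.HasRationalTwoTorsionX W x₁ ∧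
      Literature.NumberTheory.EllipticCurves.Greenberg1999.HasRationalTwoTorsionX W x₂ ∧
      Literature.NumberTheory.EllipticCurves.Greenberg1999.HasRationalTwoTorsionX W x₃ :=
  exists_three_hasRationalTwoTorsionX_of_indexFour_of_anchor D hopt hc2 hidx
    (fun χ h1 h2 h3 h4 ↦ EtaAnchor.anchor_exists N χ h1 h2 h3 h4)

/-- **E-an-152d on the `2 ∣ c₀ ∧ |c₀| ≤ 2` slice, in the row's binders.**  For lattice-optimal `X₀(N)`-data with `Λ₁(f) = 2Λ₀(f)`, IF
`2 ∣ c₀` and `|c₀| ≤ 2` (the slice the C2 line `cdivision_udc` produces from CDT), then `W` has full rational `2`-torsion.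
[cite: ShimuraIATAF1971, Thm. 3.52] [cite: MontgomeryVaughan2007, Theorem 9.13] -/
theorem indexFourForcesFullRationalTwoTorsion_of_two_dvd {W : WeierstrassCurve ℚ} [W.IsElliptic] [W.IsGloballyMinimal]
    (D : ModularParametrizationData W N)
    (hopt : ∀ z ∈ D.L.lattice, ∃ w ∈ periodLattice D.f, z = D.c * w)
    (hidx : ∀ z : ℂ, z ∈ periodLatticeGamma1 D.f ↔ ∃ w ∈ periodLattice D.f, z = 2 * w)
    (h2c : (2 : ℤ) ∣ D.maninConstant) (hle : D.maninConstant.natAbs ≤ 2) :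
    ∃ x₁ x₂ x₃ : ℚ, x₁ ≠ x₂ ∧ x₁ ≠ x₃ ∧ x₂ ≠ x₃ ∧
      Literature.NumberTheory.EllipticCurves.Greenberg1999.HasRationalTwoTorsionX W x₁ ∧
      Literature.NumberTheory.EllipticCurves.Greenberg1999.HasRationalTwoTorsionX W x₂ ∧
      Literature.NumberTheory.EllipticCurves.Greenberg1999.HasRationalTwoTorsionX W x₃ := by
  have hc0 : D.c ≠ 0 := D.maninConstant_ne_zero_holds
  have hc2 : D.c.natAbs = 2 := by
    have hdvd : 2 ∣ D.c.natAbs := by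
      have := Int.natAbs_dvd_natAbs.mpr h2c
      simpa [ModularParametrizationData.maninConstant] using this
    have hne : D.c.natAbs ≠ 0 := Int.natAbs_ne_zero.mpr hc0
    have hle' : D.c.natAbs ≤ 2 := by simpa [ModularParametrizationData.maninConstant] using hle
    omega
  exact exists_three_hasRationalTwoTorsionX_of_indexFour D hopt hc2 hidx

/-- **C2 `ManinOddAtFour` ⟸ CDT ∧ E-an-152e.**  Given the printed Calegari–Dimitrov–Tang theorem (`CDT_algInt`) and the index-`4` exclusion on the
Frey habitat (row E-an-152e `ShimuraIndexNeFourAtFourFreyHabitat`), the crux C2 holds: lattice-optimal `X₀(N)`-curves with `4 ∣ N` have odd Manin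
constant.  This is `maninOddAtFour_of_CDT_anchor_freyHabitat` with the anchor hypothesis discharged by `EtaAnchor.anchor_exists`.  CONDITIONAL on
the two displayed hypotheses; BSD is not proved. [cite: CalegariDimitrovTang2025, Thm. 1.0.1] [cite: LingOesterle1991, Thm. 6] [cite: Stevens1989, §2] -/
theorem maninOddAtFour_of_CDT_freyHabitat'
    (hCDT : Literature.NumberTheory.Automorphic.CalegariDimitrovTang2025_unboundedDenominators_algInt)
    (he : CDivisionNeron.ShimuraIndexNeFourAtFourFreyHabitat) :
    Summit.BirchSwinnertonDyer.BirchSwinnertonDyer.Theses.ManinLocalTwoThree.ManinOddAtFour :=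
  maninOddAtFour_of_CDT_anchor_freyHabitat hCDT (fun N _ χ h1 h2 h3 h4 ↦ EtaAnchor.anchor_exists N χ h1 h2 h3 h4) he

/-- **`c₀ = ±1` at `v₂(N) ≥ 2` ⟸ the printed facts ∧ CDT ∧ E-an-152e** (by-name consumer form: Mazur, Abbes–Ullmo, Česnavičius, newform existence are the
binders of `ManinOddAtFour` itself). [cite: CalegariDimitrovTang2025, Thm. 1.0.1] [cite: Cesnavicius2018, Thm. 1.2] -/
theorem maninOddAtFour_holds_of_CDT_freyHabitat
    (hCDT : Literature.NumberTheory.Automorphic.CalegariDimitrovTang2025_unboundedDenominators_algInt)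
    (he : CDivisionNeron.ShimuraIndexNeFourAtFourFreyHabitat)
    (hM : Literature.NumberTheory.EllipticCurves.ModularForms.mazur_not_dvd_maninConstant_of_odd)
    (hAU : Literature.NumberTheory.EllipticCurves.ModularForms.abbesUllmo_not_dvd_maninConstant_of_not_dvd_level)
    (hC : Literature.NumberTheory.EllipticCurves.ModularForms.cesnavicius_not_two_dvd_maninConstant_of_two_dvd_level)
    (hnf : Literature.NumberTheory.EllipticCurves.ModularForms.exists_isNewformOf)
    (W : WeierstrassCurve ℚ) [W.IsElliptic] [W.IsGloballyMinimal] (D : ModularParametrizationData W N)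
    (hopt : ∀ z ∈ D.L.lattice, ∃ w ∈ periodLattice D.f, z = D.c * w) (h4 : 2 ^ 2 ∣ N) :
    ¬ (2 : ℤ) ∣ D.maninConstant :=
  maninOddAtFour_of_CDT_freyHabitat' hCDT he hM hAU hC hnf W D hopt h4

/-- **C2 `ManinOddAtFour` ⟸ CDT THEOREM 1.0.1 (as printed, `ℤ`-coefficients) ∧ E-an-152e.**  At levels with an odd `p² ∣ N`, `|c₀| = 1` outright
(`CDivisionInt.abs_maninConstant_eq_one_of_CDTInt_of_odd_sq_dvd`); on the odd-squarefree locus `2 ∣ c₀` forces `Λ₁(f) = 2Λ₀(f)` and `|c₀| = 2`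
(`CDivisionInt`: `Λ₁(f) ⊆ Λ_W`, `c₀ ∣ 2`), hence full rational `2`-torsion by E-an-152d♭ (`indexFourForcesFullRationalTwoTorsion_of_two_dvd`), which row
E-an-152e excludes.  Two stubs only: the printed theorem and the OPEN row E-an-152e.  CONDITIONAL; C2, Manin's conjecture and BSD are not proved by this.
[cite: CalegariDimitrovTang2025, Thm. 1.0.1] [cite: LingOesterle1991, Thm. 6] [cite: Stevens1989, §2] -/
theorem maninOddAtFour_of_CDTInt_freyHabitat'
    (hCDT : Literature.NumberTheory.Automorphic.CalegariDimitrovTang2025_unboundedDenominators)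
    (he : CDivisionNeron.ShimuraIndexNeFourAtFourFreyHabitat) :
    Summit.BirchSwinnertonDyer.BirchSwinnertonDyer.Theses.ManinLocalTwoThree.ManinOddAtFour := by
  intro _hM _hAU _hC _hnf W _ _ N _ D hopt h4
  have hSI := CDivisionInt.periodLatticeGamma1_le_neron_of_CDTInt hCDT D
  by_cases hsq : ∃ p : ℕ, p.Prime ∧ 3 ≤ p ∧ p ^ 2 ∣ N
  · obtain ⟨p, hp, h3, hpN⟩ := hsq
    exact CDivisionNeron.not_prime_dvd_of_abs_eq_one
      (CDivisionInt.abs_maninConstant_eq_one_of_CDTInt_of_odd_sq_dvd hCDT D hopt hp h3 hpN) Nat.prime_two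
  · intro h2c
    simp only [not_exists, not_and] at hsq
    have hidx := CDivisionNeron.indexFour_of_gamma1Periods_le_of_four_dvd_of_two_dvd D hopt hSI h4 h2c
    have hdvd2 : D.maninConstant ∣ 2 := CDivisionInt.maninConstant_dvd_two_of_CDTInt_of_four_dvd hCDT D hopt h4
    have hle : D.maninConstant.natAbs ≤ 2 := Nat.le_of_dvd two_pos (by simpa using Int.natAbs_dvd_natAbs.mpr hdvd2)
    obtain ⟨x₁, x₂, x₃, h12, h13, h23, hx₁, hx₂, hx₃⟩ := indexFourForcesFullRationalTwoTorsion_of_two_dvd D hopt hidx h2c hle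
    exact he W D hopt h4 (fun p hp h3 ↦ hsq p hp h3) ⟨x₁, x₂, x₃, h12, h13, h23, hx₁, hx₂, hx₃⟩ hidx

/-- **THE WHOLE ROUTE: `ManinConstantOne` ⟸ PrintedSemistableManinFacts ∧ CDT Theorem 1.0.1 ∧ E-an-152e** — through the route's `closes`, with C3 and the residual
C5 from p2's `CDivisionInt` chain and C2 from `maninOddAtFour_of_CDTInt_freyHabitat'`.  CONDITIONAL architecture: the printed facts (Mazur, Abbes–Ullmo, Česnavičius,
modularity, CDT) are statement-only inputs and E-an-152e is an OPEN row.  MANIN'S CONJECTURE AND BSD ARE NOT PROVED BY THIS.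
[cite: CalegariDimitrovTang2025, Thm. 1.0.1] [cite: Cesnavicius2018, Thm. 1.2] [cite: Stevens1989, §2] -/
theorem maninConstantOne_of_printedFacts_CDTInt_freyHabitat'
    (hPF : Summit.BirchSwinnertonDyer.BirchSwinnertonDyer.Theses.ManinLocalTwoThree.PrintedSemistableManinFacts)
    (hCDT : Literature.NumberTheory.Automorphic.CalegariDimitrovTang2025_unboundedDenominators)
    (he : CDivisionNeron.ShimuraIndexNeFourAtFourFreyHabitat) :
    Summit.BirchSwinnertonDyer.Rank1Residual.ManinConstant.ManinConstantOne :=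
  Summit.BirchSwinnertonDyer.BirchSwinnertonDyer.Theses.ManinLocalTwoThree.closes hPF
    (maninOddAtFour_of_CDTInt_freyHabitat' hCDT he)
    (CDivisionInt.maninPrimeToThreeAtNine_of_CDTInt hCDT)
    (CDivisionInt.maninPrimeToAdditiveFiveLe_of_CDTInt hCDT)
    maninLocalTwoThree_assembly_proof

end Summit.BirchSwinnertonDyer.BirchSwinnertonDyer.Theorems.ManinLocalTwoThree.CDivTranslate

end
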